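import Mathlib
import Literature.NumberTheory.Transcendental.BlochWignerDilogarithm
import HarnessLib

/-!
# `ZagierDilogarithmConjecture` (stmt-KontsevichZagierPeriods-10550) — line
`kummer-clausen-linearisation` (reshape c4, "the cyclotomic sector, exactly"), stub
`stub_milnorRationalForm`

**Milnor's conjecture, `ℤ`-form versus `ℚ`-form.** Fix `N ≥ 1`, put `ζ_N = exp(2πi/N)` and let
`D` be the Bloch–Wigner dilogarithm. The line proves `crux ⇒ Milnor's conjecture` in the `ℤ`-form:
for every `m : ℤ/N → ℤ` supported on the primitive residues of the open upper half
(`(c, N) = 1`, `0 < c < N/2`), `Σ_c m_c D(ζ_N^c) = 0 ⇒ m = 0`. Milnor's conjecture is classically the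
`ℚ`-LINEAR INDEPENDENCE of the Clausen values `D(ζ_N^c) = Cl₂(2πc/N)` indexed by those residues.
This file proves the purely algebraic equivalence of the two forms; nothing about `D` is used
beyond its being a real-valued function.

Proof (what / why).
* `MilnorRationalForm.int_form_iff_linearIndependent_rat`: for a finite family `v : ι → ℝ`, the
  `ℤ`-form `∀ m : ι → ℤ, Σ mᵢ vᵢ = 0 → m = 0` is `LinearIndependent ℤ v`
  (`Fintype.linearIndependent_iff`, `zsmul_eq_mul`), and `ℤ`-independence is `ℚ`-independence in
  a `ℚ`-vector space (`LinearIndependent.iff_fractionRing`, clearing denominators).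
* `MilnorRationalForm.int_form_subtype_iff`: functions `m : α → ℤ` supported inside a predicate `P`
  are the extensions by zero of functions on the subtype `{c // P c}`, and the two weighted sums
  agree (`Finset.sum_filter_of_ne`, `Finset.sum_subtype`).
Sorry-free; axioms ⊆ {propext, Classical.choice, Quot.sound}.

## References

* J. Milnor, *Hyperbolic geometry: the first 150 years*, Bull. AMS 6 (1982), Appendix (the
  conjecture on the rational linear independence of `Л(πc/N)`, `(c, N) = 1`, `0 < c < N/2`).
  [Milnor1982]
-/

noncomputable section

open scoped BigOperators
open Literature.NumberTheory.Transcendental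

namespace Summit.KontsevichZagierPeriods.HyperbolicBloch.ZagierDilogarithmCyclotomic

namespace MilnorRationalForm

/-- **Clearing denominators.** For a finite family of reals `v`, the `ℤ`-form of independence
(`Σ mᵢ vᵢ = 0` with `mᵢ ∈ ℤ` forces `m = 0`) is equivalent to `ℚ`-linear independence. [folklore] -/
theorem int_form_iff_linearIndependent_rat {ι : Type*} [Fintype ι] (v : ι → ℝ) :
    (∀ m : ι → ℤ, ∑ i, (m i : ℝ) * v i = 0 → ∀ i, m i = 0) ↔ LinearIndependent ℚ v := by
  rw [← LinearIndependent.iff_fractionRing ℤ ℚ, Fintype.linearIndependent_iff]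
  simp only [zsmul_eq_mul]

/-- A weighted sum whose integer weights are supported inside `P` is the corresponding sum over the
subtype `{c // P c}`. [folklore] -/
theorem sum_eq_sum_subtype {α : Type*} [Fintype α] (P : α → Prop) [DecidablePred P]
    (w : α → ℝ) (m : α → ℤ) (hm : ∀ c, m c ≠ 0 → P c) :
    ∑ c, (m c : ℝ) * w c = ∑ i : {c // P c}, (m i : ℝ) * w i := by
  rw [← Finset.sum_filter_of_ne (s := Finset.univ) (p := P) (fun c _ h => hm c ?_)]
  · exact Finset.sum_subtype _ (by simp) (fun c => (m c : ℝ) * w c)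
  · intro h0
    rw [h0, Int.cast_zero, zero_mul] at h
    exact h rfl

/-- **Extension by zero / restriction.** The `ℤ`-form of independence for integer weight functions on
`α` supported inside a predicate `P` is equivalent to the `ℤ`-form for weight functions on the
subtype `{c // P c}`. [folklore] -/
theorem int_form_subtype_iff {α : Type*} [Fintype α] (P : α → Prop) [DecidablePred P]
    (w : α → ℝ) :
    (∀ m : α → ℤ, (∀ c, m c ≠ 0 → P c) → ∑ c, (m c : ℝ) * w c = 0 → ∀ c, m c = 0) ↔
      ∀ m : {c // P c} → ℤ, ∑ i, (m i : ℝ) * w i = 0 → ∀ i, m i = 0 := by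
  constructor
  · intro H m hsum i
    -- extend `m` by zero off `P`
    let m' : α → ℤ := fun c => if h : P c then m ⟨c, h⟩ else 0
    have hsupp : ∀ c, m' c ≠ 0 → P c := by
      intro c hc
      by_contra h
      exact hc (by simp [m', h])
    have hm' : ∀ j : {c // P c}, m' j = m j := fun j => by simp [m', j.2]
    have key : ∑ c, (m' c : ℝ) * w c = 0 := by
      rw [sum_eq_sum_subtype P w m' hsupp, ← hsum]
      exact Finset.sum_congr rfl fun j _ => by rw [hm' j]
    rw [← hm' i]
    exact H m' hsupp key i
  · intro H m hsupp hsum c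
    -- restrict `m` to the subtype
    have key : ∑ i : {c // P c}, (m i : ℝ) * w i = 0 := by
      rw [← sum_eq_sum_subtype P w m hsupp]
      exact hsum
    by_contra hc
    exact hc (H (fun i => m i) key ⟨c, hsupp c hc⟩)

end MilnorRationalForm

open MilnorRationalForm

/-- **Milnor's conjecture, `ℤ`-form versus `ℚ`-form** (stub `stub_milnorRationalForm`). For every
`N ≥ 1`, the `ℤ`-linear independence statement used by `crux_implies_milnor` — every
`m : ℤ/N → ℤ` supported on the primitive residues `c` of the open upper half (`(c, N) = 1`,
`0 < c < N/2`) with `Σ_c m_c D(ζ_N^c) = 0` vanishes — is equivalent to the `ℚ`-linear independence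
(`LinearIndependent ℚ`) of the family `c ↦ D(ζ_N^c)` on those residues: clearing denominators, and
extension by zero / restriction between `ℤ/N` and the subtype. [cite: Milnor1982, Appendix] -/
theorem stub_milnorRationalForm :
    ∀ (N : ℕ) [NeZero N],
      (∀ m : ZMod N → ℤ, (∀ c, m c ≠ 0 → IsUnit c ∧ 0 < c.val ∧ 2 * c.val < N) →
          ∑ c : ZMod N, (m c : ℝ) *
              blochWignerDilog (Complex.exp (2 * Real.pi * Complex.I / N) ^ c.val) = 0 →
            ∀ c, m c = 0) ↔
        LinearIndependent ℚ (fun c : {c : ZMod N // IsUnit c ∧ 0 < c.val ∧ 2 * c.val < N} =>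
          blochWignerDilog (Complex.exp (2 * Real.pi * Complex.I / N) ^ (c : ZMod N).val)) := by
  intro N _
  classical
  rw [int_form_subtype_iff (fun c : ZMod N => IsUnit c ∧ 0 < c.val ∧ 2 * c.val < N)
    (fun c => blochWignerDilog (Complex.exp (2 * Real.pi * Complex.I / N) ^ c.val))]
  exact int_form_iff_linearIndependent_rat _

end Summit.KontsevichZagierPeriods.HyperbolicBloch.ZagierDilogarithmCyclotomic

end
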